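import Literature.NumberTheory.Sieve.GoldstonPintzYildirimShift
import Literature.NumberTheory.Sieve.CoprimeSquarefreeSums
import HarnessLib

/-!
# The sharp Goldston–Yıldırım sums, I: the one-variable Möbius sums `M(y)` and `M_q(y)`

Trunk T-SIEVE. First file of the PROOF of Green–Tao's Proposition 9.8 (the linear forms condition
for the majorant `ν` of Definition 9.3, `Literature.NumberTheory.Sieve.GreenTao2008.MeasureLinearForms`),
B. Green, T. Tao, *The primes contain arbitrarily long arithmetic progressions*, Ann. of Math. 167
(2008), §§9–10. The tree already reduces Prop. 9.8 to a Goldston–Yıldırım linear forms asymptotic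
for the SHARPLY truncated divisor sum `Λ_R(n) = ∑_{d ∣ n, d ≤ R} μ(d) log(R/d)` on boxes
(`linearFormsCondition_of_boxAsymptotic`, file `GreenTao2008LinearFormsProofs`). The printed proof of
that asymptotic (Prop. 9.5: §10 and Appendix A of the source) evaluates a `2m`-fold contour integral
(Lemma 10.4) by induction on `m`, shifting contours into the classical zero-free region of `ζ`.

The formalisation follows a different bookkeeping of the SAME main term (10.2): after the
Chinese-remainder step and the local factor estimate (Lemma 10.1, in the tree's `CFZ.*` files) the
multiplicative weight `∏_p (-1)^{|X_p|+|X'_p|} ω_{X_p ∪ X'_p}(p)` is compared with the product model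
in which distinct forms are independent; the difference is supported on primes `p > w` dividing two
of the `d_i d'_i` and costs `O(1/w)` (this is the content of `G₁(0,0) = 1 + o(1)`, Lemma 10.3), and
the model term FACTORISES into one-dimensional Selberg-diagonalised sums built from

  `M_q(y) = ∑_{a ≤ y, (a,q)=1} μ(a)/a · log(y/a)`,  `M(y) = M_1(y)`.

All the analytic depth of Prop. 9.5 (the zero-free region, Lemma A.1) is then concentrated in the
single one-variable statement `M(y) = 1 + O(e^{-c√log y})`, which is EXACTLY the case `k = 1`,
`H = {0}` of the tree's proved Goldston–Pintz–Yıldırım contour shift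
(`Literature.NumberTheory.Sieve.GPY.exists_abs_mainTR_sub_singularSeries_le`, GPY (6.18):
`T_R(N;{0}) = M(R)`, `𝔖({0}) = 1`). This file proves:

* `moebLog`, `moebLogCop` (`M`, `M_q`); `mainTR_singleton_zero`, `singularSeriesNat_singleton_zero`,
  `exists_abs_moebLog_sub_one_le` (`|M(y) - 1| ≤ e^{-c√log y}`, `y ≥ R₀`), `exists_moebLog_bound`
  (`|M(y)| ≤ B`);
* `radInd q` (indicator of `rad k ∣ q`), `radInd_mul_moebius` (`𝟙_{rad ∣ q} * μ = μ · 𝟙_{(·,q)=1}`),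
  `moebLogCop_eq_sum` (`M_q(y) = ∑_{k ≤ y, rad k ∣ q} M(y/k)/k`);
* the `q`-smooth harmonic sums: `sum_radInd_div_le` (`∑_{k ≤ N, rad k ∣ q} 1/k ≤ q/φ(q)`),
  `sum_radInd_rpow_le` (`∑ k^{-1/2} ≤ Π_q = ∏_{p ∣ q} (1 - p^{-1/2})⁻¹`), the Rankin tail
  `sum_radInd_div_Ioc_le` and `totient_ratio_le_sum_radInd_add` (`q/φ(q) ≤ ∑_{k ≤ N} + N^{-1/2} Π_q`);
* `abs_moebLogCop_le` (`|M_q(y)| ≤ B q/φ(q)`) and `abs_moebLogCop_sub_le`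
  (`|M_q(y) - q/φ(q)| ≤ η q/φ(q) + (B+2) (U/y)^{1/2} Π_q` whenever `|M(u) - 1| ≤ η` for `u ≥ U`).

## References

* B. Green, T. Tao, Ann. of Math. (2) 167 (2008), 481–547: Prop. 9.5, §10 (10.1)–(10.9),
  Lemma 10.3, App. A Lemma A.1. [cite: GreenTaoAnnals2008]
* D. A. Goldston, J. Pintz, C. Y. Yıldırım, *Primes in tuples. I*, Ann. of Math. 170 (2009),
  §6 (6.18) (the one-variable contour shift used here). [cite: GoldstonPintzYildirim2009]
-/

noncomputable section

open Finset Filter Real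
open scoped ArithmeticFunction.Moebius ArithmeticFunction.zeta ArithmeticFunction.omega

namespace Literature.NumberTheory.Sieve.GreenTao2008.SharpGY

open Literature.NumberTheory.Sieve.SquarefreeSums (copInd copInd_apply copInd_apply_of_coprime
  copInd_apply_of_not_coprime copInd_apply_prime_pow isMultiplicative_copInd mul_apply_prime_pow
  sum_Icc_sum_divisorsAntidiagonal sum_le_prod_sum_prime_pow)

/-! ### The Möbius sums `M(y)` and `M_q(y)` -/

/-- `M(y) = ∑_{a ≤ y} μ(a)/a · log(y/a)` (`= 0` for `y < 1`): the one-variable sum to which the sharp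
Goldston–Yıldırım main term reduces; `M(R) = T_R(N; {0})` of Goldston–Pintz–Yıldırım (6.5).
[cite: GreenTaoAnnals2008, Section 10 eq. 10.2] -/
def moebLog (y : ℝ) : ℝ := ∑ a ∈ Icc 1 ⌊y⌋₊, (μ a : ℝ) / a * Real.log (y / a)

/-- `M_q(y) = ∑_{a ≤ y, (a,q)=1} μ(a)/a · log(y/a)`. [cite: GreenTaoAnnals2008, Section 10 eq. 10.2] -/
def moebLogCop (q : ℕ) (y : ℝ) : ℝ :=
  ∑ a ∈ (Icc 1 ⌊y⌋₊).filter (fun a => a.Coprime q), (μ a : ℝ) / a * Real.log (y / a)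

/-- `M(y) = 0` for `y < 1`. [folklore] -/
theorem moebLog_eq_zero_of_lt_one {y : ℝ} (hy : y < 1) : moebLog y = 0 := by
  unfold moebLog
  have : ⌊y⌋₊ = 0 := Nat.floor_eq_zero.2 hy
  rw [this]
  simp

/-- `M_1 = M`. [folklore] -/
theorem moebLogCop_one (y : ℝ) : moebLogCop 1 y = moebLog y := by
  unfold moebLogCop moebLog
  rw [Finset.filter_true_of_mem fun a _ => Nat.coprime_one_right a]

/-- Crude bound `|M(y)| ≤ ⌊y⌋ log y` for `y ≥ 1` (each term is at most `log y`). [folklore] -/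
theorem abs_moebLog_le {y : ℝ} (hy : 1 ≤ y) : |moebLog y| ≤ ⌊y⌋₊ * Real.log y := by
  unfold moebLog
  refine (abs_sum_le_sum_abs _ _).trans ?_
  have hterm : ∀ a ∈ Icc 1 ⌊y⌋₊, |(μ a : ℝ) / a * Real.log (y / a)| ≤ Real.log y := by
    intro a ha
    obtain ⟨ha1, hay⟩ := mem_Icc.1 ha
    have ha0 : (0 : ℝ) < a := by exact_mod_cast ha1
    have hay' : (a : ℝ) ≤ y := (Nat.cast_le.2 hay).trans (Nat.floor_le (by linarith))
    have hμ : |(μ a : ℝ)| ≤ 1 := by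
      rw [← Int.cast_abs]; exact_mod_cast ArithmeticFunction.abs_moebius_le_one
    have hlog0 : 0 ≤ Real.log (y / a) := Real.log_nonneg ((one_le_div ha0).2 hay')
    have hlog : Real.log (y / a) ≤ Real.log y := by
      rw [Real.log_div (by linarith) ha0.ne']
      linarith [Real.log_nonneg (show (1 : ℝ) ≤ a by exact_mod_cast ha1)]
    rw [abs_mul, abs_div, abs_of_nonneg hlog0, Nat.abs_cast]
    calc |(μ a : ℝ)| / a * Real.log (y / a) ≤ 1 / 1 * Real.log y := by
          gcongr
          · exact_mod_cast ha1
      _ = Real.log y := by ring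
  calc ∑ a ∈ Icc 1 ⌊y⌋₊, |(μ a : ℝ) / a * Real.log (y / a)| ≤ ∑ _a ∈ Icc 1 ⌊y⌋₊, Real.log y :=
        sum_le_sum hterm
    _ = ⌊y⌋₊ * Real.log y := by rw [sum_const, Nat.card_Icc, nsmul_eq_mul]; simp

/-! ### `M(y) → 1` from the Goldston–Pintz–Yıldırım contour shift -/

/-- `ν_d({0}) = 1` for every `d`. [cite: GoldstonPintzYildirim2009, Section 6 eq. 6.4] -/
theorem nu_singleton_zero (d : ℕ) : GPY.nu {0} d = 1 := by
  unfold GPY.nu GPY.nuPrime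
  exact prod_eq_one fun p _ => by simp

/-- `T_R(N; {0}) = M(R)` (GPY (6.5) with `k = 1`, `H = {0}`: `ν_d = 1`).
[cite: GoldstonPintzYildirim2009, Section 6 eq. 6.5] -/
theorem mainTR_singleton_zero (R : ℝ) : GPY.mainTR R {0} 0 = moebLog R := by
  unfold GPY.mainTR moebLog
  simp only [card_singleton, Nat.reduceAdd, Nat.factorial_one, Nat.cast_one, inv_one, one_mul,
    pow_one, nu_singleton_zero, Nat.cast_one]
  refine sum_congr rfl fun d _ => ?_
  ring

/-- `𝔖({0}) = 1`: every Euler factor `(1 - ν_p/p)(1 - 1/p)⁻¹` equals `1`.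
[cite: GoldstonPintzYildirim2009, eq. 2.2] -/
theorem singularSeriesNat_singleton_zero : GPY.singularSeriesNat {0} = 1 := by
  rw [GPY.singularSeriesNat_def]
  have himg : (({0} : Finset ℕ).image ((↑) : ℕ → ℤ)) = {(0 : ℤ)} := by simp
  rw [himg]
  have hpart : ∀ x, singularSeriesPartial {(0 : ℤ)} x = 1 := by
    intro x
    unfold singularSeriesPartial
    refine prod_eq_one fun p hp => ?_
    have hpp : p.Prime := (Nat.mem_primesLE.1 hp).2
    unfold singularSeriesFactor tupleResidueCount
    have h1 : (({(0 : ℤ)} : Finset ℤ).image fun h : ℤ => (h : ZMod p)).card = 1 := by simp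
    rw [h1, card_singleton, pow_one]
    have hp0 : (p : ℝ) ≠ 0 := by exact_mod_cast hpp.ne_zero
    have hp1 : (1 : ℝ) - 1 / p ≠ 0 := by
      have : (1 : ℝ) < p := by exact_mod_cast hpp.one_lt
      have : 1 / (p : ℝ) < 1 := by rw [div_lt_one (by linarith)]; exact this
      linarith
    push_cast
    exact mul_inv_cancel₀ hp1
  have hlim := tendsto_singularSeriesPartial_holds {(0 : ℤ)}
  have hconst : Tendsto (singularSeriesPartial {(0 : ℤ)}) atTop (nhds 1) := by
    rw [show singularSeriesPartial {(0 : ℤ)} = fun _ => 1 from funext hpart]; exact tendsto_const_nhds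
  exact tendsto_nhds_unique hlim hconst

/-- **`M(y) = 1 + O(e^{-c√log y})`** — the one-variable input carrying the zero-free region:
GPY (6.18) with `k = 1`, `H = {0}` (`T_R = M(R)`, `𝔖 = 1`), i.e. the contour shift of the tree's
`GoldstonPintzYildirimShift`. In Green–Tao's proof this is the information extracted from Lemma A.1
by Lemma A.3. [cite: GreenTaoAnnals2008, Appendix A Lemma A.3] -/
theorem exists_abs_moebLog_sub_one_le :
    ∃ c : ℝ, 0 < c ∧ ∃ R₀ : ℝ, 1 ≤ R₀ ∧ ∀ y : ℝ, R₀ ≤ y →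
      |moebLog y - 1| ≤ Real.exp (-(c * Real.sqrt (Real.log y))) := by
  obtain ⟨c, hc, R₀, h⟩ := GPY.exists_abs_mainTR_sub_singularSeries_le (k := 1) le_rfl
    (C₀ := 1) one_pos
  refine ⟨c, hc, max R₀ 1, le_max_right _ _, fun y hy => ?_⟩
  have hy0 : R₀ ≤ y := (le_max_left _ _).trans hy
  have h1 := h y hy0 0 {0} (card_singleton 0) (fun x hx => (mem_singleton.1 hx).le)
    (by rw [Nat.cast_zero]; exact Real.rpow_nonneg (by linarith [le_max_right R₀ 1]) _)
  rwa [mainTR_singleton_zero, singularSeriesNat_singleton_zero] at h1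

/-- **`M` is bounded**: `|M(y)| ≤ B` for all `y` (`B ≥ 1`). [cite: GreenTaoAnnals2008, Appendix A Lemma A.3] -/
theorem exists_moebLog_bound : ∃ B : ℝ, 1 ≤ B ∧ ∀ y : ℝ, |moebLog y| ≤ B := by
  obtain ⟨c, hc, R₀, hR₀, h⟩ := exists_abs_moebLog_sub_one_le
  refine ⟨max 2 (R₀ * Real.log R₀ + 1), by linarith [le_max_left 2 (R₀ * Real.log R₀ + 1)],
    fun y => ?_⟩
  rcases lt_or_ge y 1 with hy | hy
  · rw [moebLog_eq_zero_of_lt_one hy, abs_zero]; positivity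
  rcases le_or_gt R₀ y with hyR | hyR
  · have h1 := h y hyR
    have h2 : Real.exp (-(c * Real.sqrt (Real.log y))) ≤ 1 := by
      rw [Real.exp_le_one_iff]
      have : 0 ≤ c * Real.sqrt (Real.log y) := by positivity
      linarith
    calc |moebLog y| = |(moebLog y - 1) + 1| := by ring_nf
      _ ≤ |moebLog y - 1| + 1 := by simpa using abs_add_le (moebLog y - 1) 1
      _ ≤ 2 := by linarith
      _ ≤ _ := le_max_left _ _
  · have h1 := abs_moebLog_le hy
    have hfl : (⌊y⌋₊ : ℝ) ≤ R₀ := (Nat.floor_le (by linarith)).trans hyR.le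
    have hlog : Real.log y ≤ Real.log R₀ := Real.log_le_log (by linarith) hyR.le
    have hlog0 : 0 ≤ Real.log y := Real.log_nonneg hy
    calc |moebLog y| ≤ ⌊y⌋₊ * Real.log y := h1
      _ ≤ R₀ * Real.log R₀ := mul_le_mul hfl hlog hlog0 (by linarith)
      _ ≤ R₀ * Real.log R₀ + 1 := by linarith
      _ ≤ _ := le_max_right _ _

/-- `M(u) → 1`: for every `η > 0` there is `U ≥ 1` with `|M(u) - 1| ≤ η` for `u ≥ U`.
[cite: GreenTaoAnnals2008, Appendix A Lemma A.3] -/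
theorem exists_abs_moebLog_sub_one_le_of_pos {η : ℝ} (hη : 0 < η) :
    ∃ U : ℝ, 1 ≤ U ∧ ∀ u : ℝ, U ≤ u → |moebLog u - 1| ≤ η := by
  obtain ⟨c, hc, R₀, hR₀, h⟩ := exists_abs_moebLog_sub_one_le
  -- `exp(-c √log u) ≤ η` as soon as `√log u ≥ -log η / c`
  obtain ⟨T, hT⟩ : ∃ T : ℝ, ∀ u : ℝ, T ≤ u → Real.exp (-(c * Real.sqrt (Real.log u))) ≤ η := by
    have ht : Tendsto (fun u : ℝ => Real.exp (-(c * Real.sqrt (Real.log u)))) atTop (nhds 0) := by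
      have h1 : Tendsto (fun u : ℝ => c * Real.sqrt (Real.log u)) atTop atTop :=
        Tendsto.const_mul_atTop hc (Real.tendsto_sqrt_atTop.comp Real.tendsto_log_atTop)
      exact Real.tendsto_exp_neg_atTop_nhds_zero.comp h1
    have := (ht.eventually (ge_mem_nhds hη)).exists_forall_of_atTop
    obtain ⟨T, hT⟩ := this
    exact ⟨T, hT⟩
  refine ⟨max R₀ T, le_trans hR₀ (le_max_left _ _), fun u hu => ?_⟩
  exact (h u ((le_max_left _ _).trans hu)).trans (hT u ((le_max_right _ _).trans hu))


/-! ### The indicator of `rad k ∣ q` and the identity `M_q(y) = ∑_{rad k ∣ q} M(y/k)/k` -/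

/-- `𝟙[k ≥ 1 ∧ rad k ∣ q]` (every prime factor of `k` divides `q`), a multiplicative real
arithmetic function. [folklore] -/
def radInd (q : ℕ) : ArithmeticFunction ℝ :=
  ⟨fun k => if k ≠ 0 ∧ k.primeFactors ⊆ q.primeFactors then 1 else 0, by simp⟩

/-- Unfolding `radInd`. [folklore] -/
theorem radInd_apply (q k : ℕ) :
    radInd q k = if k ≠ 0 ∧ k.primeFactors ⊆ q.primeFactors then 1 else 0 := rfl

/-- `radInd q k ∈ {0, 1}`, in particular `0 ≤ radInd q k ≤ 1`. [folklore] -/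
theorem radInd_nonneg_le_one (q k : ℕ) : 0 ≤ radInd q k ∧ radInd q k ≤ 1 := by
  rw [radInd_apply]; split_ifs <;> norm_num

/-- `radInd` is multiplicative (`primeFactors (mn) = primeFactors m ∪ primeFactors n`). [folklore] -/
theorem isMultiplicative_radInd (q : ℕ) : (radInd q).IsMultiplicative := by
  refine ArithmeticFunction.IsMultiplicative.iff_ne_zero.2 ⟨?_, ?_⟩
  · simp [radInd_apply]
  · intro m n hm hn _
    have hmn : m * n ≠ 0 := mul_ne_zero hm hn
    simp only [radInd_apply, Nat.primeFactors_mul hm hn, Finset.union_subset_iff, ne_eq, hm, hn,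
      hmn, not_false_eq_true, true_and]
    by_cases h1 : m.primeFactors ⊆ q.primeFactors <;>
      by_cases h2 : n.primeFactors ⊆ q.primeFactors <;> simp [h1, h2]

/-- `radInd q (p^j) = 𝟙[p ∣ q]` for a prime `p`, `j ≥ 1`, `q ≥ 1`. [folklore] -/
theorem radInd_apply_prime_pow {q p : ℕ} (hq : q ≠ 0) (hp : p.Prime) {j : ℕ} (hj : j ≠ 0) :
    radInd q (p ^ j) = if p ∣ q then 1 else 0 := by
  rw [radInd_apply, Nat.primeFactors_prime_pow hj hp]
  have hpj : p ^ j ≠ 0 := pow_ne_zero _ hp.ne_zero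
  simp only [ne_eq, hpj, not_false_eq_true, true_and, Finset.singleton_subset_iff,
    Nat.mem_primeFactors, hp, hq, and_true, true_and]

/-- **`𝟙_{rad ∣ q} * μ = μ · 𝟙_{(·, q) = 1}`** (Dirichlet convolution; compare Euler factors:
at `p ∣ q` both sides vanish on `p^j`, `j ≥ 1`; at `p ∤ q` both equal `μ(p^j)`). [folklore] -/
theorem radInd_mul_moebius {q : ℕ} (hq : q ≠ 0) :
    radInd q * (μ : ArithmeticFunction ℝ) = (μ : ArithmeticFunction ℝ).pmul (copInd q) := by
  have hμ : (μ : ArithmeticFunction ℝ).IsMultiplicative :=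
    ArithmeticFunction.isMultiplicative_moebius.intCast
  have hL := (isMultiplicative_radInd q).mul hμ
  have hR := hμ.pmul (isMultiplicative_copInd q)
  rw [hL.eq_iff_eq_on_prime_powers _ _ hR]
  intro p j hp
  rcases Nat.eq_zero_or_pos j with rfl | hj
  · rw [pow_zero, hL.map_one, hR.map_one]
  rw [mul_apply_prime_pow _ _ hp, ArithmeticFunction.pmul_apply, copInd_apply_prime_pow hp hj.ne',
    ArithmeticFunction.intCoe_apply]
  by_cases hpq : p ∣ q
  · -- both sides vanish
    rw [if_pos hpq, mul_zero]
    have hterm : ∀ i ∈ Finset.range (j + 1),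
        radInd q (p ^ i) * (μ : ArithmeticFunction ℝ) (p ^ (j - i)) = (μ (p ^ (j - i)) : ℝ) := by
      intro i _
      rw [ArithmeticFunction.intCoe_apply]
      rcases Nat.eq_zero_or_pos i with rfl | hi
      · rw [pow_zero, (isMultiplicative_radInd q).map_one, one_mul]
      · rw [radInd_apply_prime_pow hq hp hi.ne', if_pos hpq, one_mul]
    have hrefl := Finset.sum_range_reflect (fun i => (μ (p ^ i) : ℝ)) (j + 1)
    simp only [Nat.add_sub_cancel] at hrefl
    rw [Finset.sum_congr rfl hterm, hrefl]
    rw [Finset.sum_range_succ', pow_zero, ArithmeticFunction.moebius_apply_one]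
    rw [Finset.sum_eq_single 0]
    · rw [zero_add, pow_one, ArithmeticFunction.moebius_apply_prime hp]; push_cast; ring
    · intro i _ hi
      rw [ArithmeticFunction.moebius_apply_prime_pow hp (by omega), if_neg (by omega)]
      push_cast; rfl
    · intro h; exact absurd (Finset.mem_range.2 hj) h
  · rw [if_neg hpq, mul_one]
    rw [Finset.sum_eq_single 0]
    · rw [pow_zero, (isMultiplicative_radInd q).map_one, one_mul, Nat.sub_zero,
        ArithmeticFunction.intCoe_apply]
    · intro i _ hi
      rw [radInd_apply_prime_pow hq hp hi, if_neg hpq, zero_mul]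
    · intro h; exact absurd (Finset.mem_range.2 (Nat.succ_pos j)) h

/-- **`M_q(y) = ∑_{k ≤ y, rad k ∣ q} M(y/k)/k`** (group `a ≤ y` coprime to `q` as `n = k a`... i.e.
Möbius-invert the coprimality condition through `radInd_mul_moebius` and Dirichlet's hyperbola
rearrangement). [folklore] -/
theorem moebLogCop_eq_sum {q : ℕ} (hq : q ≠ 0) (y : ℝ) :
    moebLogCop q y = ∑ k ∈ (Icc 1 ⌊y⌋₊).filter (fun k => k.primeFactors ⊆ q.primeFactors),
      moebLog (y / k) / k := by
  set Y := ⌊y⌋₊ with hY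
  -- the right-hand side as a double sum over `k a ≤ Y`
  set F : ℕ → ℕ → ℝ := fun k a => radInd q k * (μ a : ℝ) * (Real.log (y / (k * a : ℕ)) / (k * a : ℕ))
    with hF
  have hrhs : ∑ k ∈ (Icc 1 Y).filter (fun k => k.primeFactors ⊆ q.primeFactors), moebLog (y / k) / k =
      ∑ k ∈ Icc 1 Y, ∑ a ∈ Icc 1 (Y / k), F k a := by
    rw [Finset.sum_filter]
    refine Finset.sum_congr rfl fun k hk => ?_
    have hk1 : 1 ≤ k := (mem_Icc.1 hk).1
    have hk0 : (k : ℝ) ≠ 0 := by exact_mod_cast (show k ≠ 0 by omega)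
    have hfl : ⌊y / k⌋₊ = Y / k := by rw [hY, Nat.floor_div_natCast]
    split_ifs with hsub
    · have hind : radInd q k = 1 := by rw [radInd_apply, if_pos ⟨by omega, hsub⟩]
      unfold moebLog
      rw [hfl, Finset.sum_div]
      refine Finset.sum_congr rfl fun a ha => ?_
      have ha0 : (a : ℝ) ≠ 0 := by exact_mod_cast (show a ≠ 0 by have := (mem_Icc.1 ha).1; omega)
      simp only [hF, hind, one_mul]
      push_cast
      field_simp
    · have hind : radInd q k = 0 := by
        rw [radInd_apply, if_neg (fun h => hsub h.2)]
      symm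
      exact Finset.sum_eq_zero fun a _ => by simp [hF, hind]
  rw [hrhs, ← sum_Icc_sum_divisorsAntidiagonal F Y]
  -- the left-hand side via the convolution identity
  unfold moebLogCop
  rw [Finset.sum_filter]
  refine Finset.sum_congr rfl fun n hn => ?_
  have hn1 : 1 ≤ n := (mem_Icc.1 hn).1
  have hconv := congrArg (fun f : ArithmeticFunction ℝ => f n) (radInd_mul_moebius hq)
  simp only [ArithmeticFunction.mul_apply, ArithmeticFunction.pmul_apply,
    ArithmeticFunction.intCoe_apply] at hconv
  have hinner : ∑ x ∈ n.divisorsAntidiagonal, F x.1 x.2 =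
      (∑ x ∈ n.divisorsAntidiagonal, radInd q x.1 * (μ x.2 : ℝ)) * (Real.log (y / n) / n) := by
    rw [Finset.sum_mul]
    refine Finset.sum_congr rfl fun x hx => ?_
    have hxn : x.1 * x.2 = n := (Nat.mem_divisorsAntidiagonal.1 hx).1
    simp only [hF, hxn]
  rw [hinner, hconv, copInd_apply]
  by_cases hc : n.Coprime q
  · rw [if_pos hc, if_pos ⟨by omega, hc⟩]; ring
  · rw [if_neg hc, if_neg (fun h => hc h.2)]; ring

/-! ### The `q`-smooth harmonic sums (Rankin) -/

/-- `k ↦ k^{-s}` (`k ≥ 1`), a completely multiplicative real arithmetic function. [folklore] -/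
def rpowAF (s : ℝ) : ArithmeticFunction ℝ := ⟨fun k => if k = 0 then 0 else (k : ℝ) ^ (-s), rfl⟩

/-- Unfolding `rpowAF`. [folklore] -/
theorem rpowAF_apply (s : ℝ) (k : ℕ) : rpowAF s k = if k = 0 then 0 else (k : ℝ) ^ (-s) := rfl

/-- `rpowAF s k = k^{-s}` for `k ≠ 0`. [folklore] -/
theorem rpowAF_apply_of_ne_zero (s : ℝ) {k : ℕ} (hk : k ≠ 0) : rpowAF s k = (k : ℝ) ^ (-s) := by
  rw [rpowAF_apply, if_neg hk]

/-- `rpowAF s` is multiplicative. [folklore] -/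
theorem isMultiplicative_rpowAF (s : ℝ) : (rpowAF s).IsMultiplicative := by
  refine ArithmeticFunction.IsMultiplicative.iff_ne_zero.2 ⟨?_, ?_⟩
  · simp [rpowAF_apply]
  · intro m n hm hn _
    rw [rpowAF_apply_of_ne_zero s (mul_ne_zero hm hn), rpowAF_apply_of_ne_zero s hm,
      rpowAF_apply_of_ne_zero s hn, Nat.cast_mul,
      Real.mul_rpow (Nat.cast_nonneg _) (Nat.cast_nonneg _)]

/-- The Rankin factor `Π_q(s) = ∏_{p ∣ q} (1 - p^{-s})⁻¹`. [folklore] -/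
def rankinProd (s : ℝ) (q : ℕ) : ℝ := ∏ p ∈ q.primeFactors, (1 - (p : ℝ) ^ (-s))⁻¹

/-- For a prime `p` and `s > 0`: `0 ≤ p^{-s} < 1`. [folklore] -/
theorem prime_rpow_neg_lt_one {p : ℕ} (hp : p.Prime) {s : ℝ} (hs : 0 < s) :
    0 ≤ (p : ℝ) ^ (-s) ∧ (p : ℝ) ^ (-s) < 1 := by
  refine ⟨Real.rpow_nonneg (Nat.cast_nonneg _) _, ?_⟩
  exact Real.rpow_lt_one_of_one_lt_of_neg (by exact_mod_cast hp.one_lt) (by linarith)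

/-- Each Rankin factor is `≥ 1`. [folklore] -/
theorem one_le_rankinFactor {p : ℕ} (hp : p.Prime) {s : ℝ} (hs : 0 < s) :
    1 ≤ (1 - (p : ℝ) ^ (-s))⁻¹ := by
  obtain ⟨h0, h1⟩ := prime_rpow_neg_lt_one hp hs
  rw [le_inv_comm₀ one_pos (by linarith), inv_one]
  linarith

/-- A product of real factors `≥ 1` is `≥ 1`. [folklore] -/
theorem one_le_prod_real {ι : Type*} {s : Finset ι} {f : ι → ℝ} (hf : ∀ i ∈ s, 1 ≤ f i) :
    1 ≤ ∏ i ∈ s, f i := by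
  calc (1 : ℝ) = ∏ _i ∈ s, (1 : ℝ) := by simp
    _ ≤ ∏ i ∈ s, f i := Finset.prod_le_prod (fun _ _ => zero_le_one) hf

/-- `Π_q(s) ≥ 1`. [folklore] -/
theorem one_le_rankinProd {s : ℝ} (hs : 0 < s) (q : ℕ) : 1 ≤ rankinProd s q := by
  unfold rankinProd
  exact one_le_prod_real fun p hp => one_le_rankinFactor (Nat.prime_of_mem_primeFactors hp) hs

/-- Products over a subset of factors `≥ 1` (in `ℝ`). [folklore] -/
theorem prod_le_prod_of_subset_of_one_le_real {ι : Type*} [DecidableEq ι] {s t : Finset ι} (h : s ⊆ t)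
    (f : ι → ℝ) (hf : ∀ i ∈ t, 1 ≤ f i) : ∏ i ∈ s, f i ≤ ∏ i ∈ t, f i := by
  rw [← Finset.prod_sdiff h]
  have h1 : 1 ≤ ∏ i ∈ t \ s, f i := one_le_prod_real fun i hi => hf i (Finset.sdiff_subset hi)
  have h2 : 0 ≤ ∏ i ∈ s, f i := Finset.prod_nonneg fun i hi => zero_le_one.trans (hf i (h hi))
  nlinarith

/-- **`∑_{k ≤ N, rad k ∣ q} k^{-s} ≤ Π_q(s)`** (`s > 0`): the partial sums of the nonnegative
multiplicative `𝟙_{rad ∣ q} k^{-s}` are bounded by its Euler product. [folklore] -/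
theorem sum_radInd_rpow_le {q : ℕ} (hq : q ≠ 0) (N : ℕ) {s : ℝ} (hs : 0 < s) :
    ∑ k ∈ (Icc 1 N).filter (fun k => k.primeFactors ⊆ q.primeFactors), (k : ℝ) ^ (-s) ≤
      rankinProd s q := by
  classical
  set f : ArithmeticFunction ℝ := (radInd q).pmul (rpowAF s) with hf
  have hfm : f.IsMultiplicative := (isMultiplicative_radInd q).pmul (isMultiplicative_rpowAF s)
  have hf0 : ∀ n, 0 ≤ f n := fun n => by
    simp only [hf, ArithmeticFunction.pmul_apply]
    exact mul_nonneg (radInd_nonneg_le_one q n).1 (by rw [rpowAF_apply]; split_ifs <;> positivity)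
  have hsum : ∑ k ∈ (Icc 1 N).filter (fun k => k.primeFactors ⊆ q.primeFactors), (k : ℝ) ^ (-s) =
      ∑ d ∈ Icc 1 N, f d := by
    rw [Finset.sum_filter]
    refine Finset.sum_congr rfl fun k hk => ?_
    have hk0 : k ≠ 0 := by have := (mem_Icc.1 hk).1; omega
    simp only [hf, ArithmeticFunction.pmul_apply, radInd_apply, rpowAF_apply_of_ne_zero s hk0, ne_eq,
      hk0, not_false_eq_true, true_and]
    split_ifs <;> simp
  rw [hsum]
  refine (sum_le_prod_sum_prime_pow hfm hf0 N).trans ?_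
  -- evaluate the local factors
  have hloc : ∀ p ∈ Nat.primesBelow (N + 1), ∑ j ∈ Finset.range (N + 1), f (p ^ j) ≤
      if p ∈ q.primeFactors then (1 - (p : ℝ) ^ (-s))⁻¹ else 1 := by
    intro p hp
    have hpp : p.Prime := (Nat.mem_primesBelow.1 hp).2
    have hterm : ∀ j ∈ Finset.range (N + 1), f (p ^ j) =
        if p ∈ q.primeFactors then ((p : ℝ) ^ (-s)) ^ j else (if j = 0 then 1 else 0) := by
      intro j _
      rcases Nat.eq_zero_or_pos j with rfl | hj
      · rw [pow_zero, hfm.map_one]; split_ifs <;> simp_all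
      · simp only [hf, ArithmeticFunction.pmul_apply, radInd_apply_prime_pow hq hpp hj.ne',
          rpowAF_apply_of_ne_zero s (pow_ne_zero j hpp.ne_zero), Nat.cast_pow]
        have hmem : p ∈ q.primeFactors ↔ p ∣ q := by simp [Nat.mem_primeFactors, hpp, hq]
        by_cases hpq : p ∣ q
        · rw [if_pos hpq, if_pos (hmem.2 hpq), one_mul, ← Real.rpow_natCast, ← Real.rpow_natCast,
            ← Real.rpow_mul (Nat.cast_nonneg _), ← Real.rpow_mul (Nat.cast_nonneg _), mul_comm]
        · rw [if_neg hpq, if_neg (fun h => hpq (hmem.1 h)), zero_mul, if_neg hj.ne']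
    rw [Finset.sum_congr rfl hterm]
    split_ifs with hmem
    · obtain ⟨h0, h1⟩ := prime_rpow_neg_lt_one hpp hs
      have := geom_sum_Ico_le_of_lt_one h0 h1 (m := 0) (n := N + 1)
      rw [Finset.range_eq_Ico]
      simpa using this
    · rw [Finset.sum_ite_eq']; simp
  calc ∏ p ∈ Nat.primesBelow (N + 1), ∑ j ∈ Finset.range (N + 1), f (p ^ j)
      ≤ ∏ p ∈ Nat.primesBelow (N + 1), (if p ∈ q.primeFactors then (1 - (p : ℝ) ^ (-s))⁻¹ else 1) :=
        Finset.prod_le_prod (fun p _ => Finset.sum_nonneg fun j _ => hf0 _) hloc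
    _ = ∏ p ∈ (Nat.primesBelow (N + 1)).filter (fun p => p ∈ q.primeFactors), (1 - (p : ℝ) ^ (-s))⁻¹ := by
        rw [Finset.prod_filter]
    _ ≤ rankinProd s q := by
        unfold rankinProd
        refine prod_le_prod_of_subset_of_one_le_real (fun p hp => (Finset.mem_filter.1 hp).2) _ ?_
        intro p hp
        exact one_le_rankinFactor (Nat.prime_of_mem_primeFactors hp) hs

/-- Euler's formula `q/φ(q) = ∏_{p ∣ q} (1 - 1/p)⁻¹ = Π_q(1)`. [folklore] -/
theorem div_totient_eq_rankinProd {q : ℕ} (hq : q ≠ 0) : (q : ℝ) / (q.totient : ℝ) = rankinProd 1 q := by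
  have h := Nat.totient_eq_mul_prod_factors q
  have h' : ((q.totient : ℚ) : ℝ) = ((q * ∏ p ∈ q.primeFactors, (1 - (p : ℚ)⁻¹) : ℚ) : ℝ) := by rw [h]
  push_cast at h'
  unfold rankinProd
  have hprod : (∏ p ∈ q.primeFactors, (1 - (p : ℝ) ^ (-(1 : ℝ)))) = ∏ p ∈ q.primeFactors, (1 - (p : ℝ)⁻¹) := by
    refine Finset.prod_congr rfl fun p _ => ?_
    rw [Real.rpow_neg (Nat.cast_nonneg _), Real.rpow_one]
  rw [Finset.prod_inv_distrib, hprod, h']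
  have hq' : (q : ℝ) ≠ 0 := by exact_mod_cast hq
  have hP : (∏ p ∈ q.primeFactors, (1 - (p : ℝ)⁻¹)) ≠ 0 := by
    refine Finset.prod_ne_zero_iff.2 fun p hp => ?_
    have hp2 : (2 : ℝ) ≤ p := by exact_mod_cast (Nat.prime_of_mem_primeFactors hp).two_le
    have : (p : ℝ)⁻¹ ≤ 1 / 2 := by rw [inv_eq_one_div]; exact one_div_le_one_div_of_le two_pos hp2
    linarith
  field_simp

/-- **`∑_{k ≤ N, rad k ∣ q} 1/k ≤ q/φ(q)`.** [folklore] -/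
theorem sum_radInd_div_le {q : ℕ} (hq : q ≠ 0) (N : ℕ) :
    ∑ k ∈ (Icc 1 N).filter (fun k => k.primeFactors ⊆ q.primeFactors), (1 : ℝ) / k ≤
      (q : ℝ) / (q.totient : ℝ) := by
  rw [div_totient_eq_rankinProd hq]
  have h := sum_radInd_rpow_le hq N one_pos
  refine le_trans (le_of_eq ?_) h
  refine Finset.sum_congr rfl fun k _ => ?_
  rw [Real.rpow_neg (Nat.cast_nonneg _), Real.rpow_one, one_div]

/-- **Rankin's tail bound**: for `V ≥ 1`, `∑_{V < k ≤ N, rad k ∣ q} 1/k ≤ V^{-1/2} Π_q(1/2)`.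
[folklore] -/
theorem sum_radInd_div_Ioc_le {q : ℕ} (hq : q ≠ 0) {V : ℝ} (hV : 1 ≤ V) (N : ℕ) :
    ∑ k ∈ (Ioc ⌊V⌋₊ N).filter (fun k => k.primeFactors ⊆ q.primeFactors), (1 : ℝ) / k ≤
      V ^ (-(1 / 2 : ℝ)) * rankinProd (1 / 2) q := by
  have hV0 : 0 < V := by linarith
  have hstep : ∀ k ∈ (Ioc ⌊V⌋₊ N).filter (fun k => k.primeFactors ⊆ q.primeFactors),
      (1 : ℝ) / k ≤ V ^ (-(1 / 2 : ℝ)) * (k : ℝ) ^ (-(1 / 2 : ℝ)) := by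
    intro k hk
    have hk' := (Finset.mem_Ioc.1 (Finset.mem_filter.1 hk).1).1
    have hVk : V ≤ k := (Nat.lt_of_floor_lt hk').le
    have hk0 : (0 : ℝ) < k := by linarith
    have hsplit : (1 : ℝ) / k = (k : ℝ) ^ (-(1 / 2 : ℝ)) * (k : ℝ) ^ (-(1 / 2 : ℝ)) := by
      rw [← Real.rpow_add hk0, show (-(1 / 2 : ℝ)) + -(1 / 2 : ℝ) = -1 by norm_num, Real.rpow_neg_one,
        one_div]
    rw [hsplit]
    refine mul_le_mul_of_nonneg_right ?_ (Real.rpow_nonneg hk0.le _)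
    exact Real.rpow_le_rpow_of_nonpos hV0 hVk (by norm_num)
  refine (Finset.sum_le_sum hstep).trans ?_
  rw [← Finset.mul_sum]
  refine mul_le_mul_of_nonneg_left ?_ (Real.rpow_nonneg hV0.le _)
  refine le_trans ?_ (sum_radInd_rpow_le hq N (by norm_num : (0 : ℝ) < 1 / 2))
  refine Finset.sum_le_sum_of_subset_of_nonneg ?_ fun k _ _ => Real.rpow_nonneg (Nat.cast_nonneg _) _
  intro k hk
  rw [Finset.mem_filter] at hk ⊢
  refine ⟨?_, hk.2⟩
  have := Finset.mem_Ioc.1 hk.1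
  exact Finset.mem_Icc.2 ⟨by omega, this.2⟩

/-- The divisors of `(rad q)^J` have all their prime factors among those of `q`. [folklore] -/
theorem primeFactors_subset_of_dvd_radical_pow {q J k : ℕ}
    (hk : k ∈ ((∏ p ∈ q.primeFactors, p) ^ J).divisors) : k ≠ 0 ∧ k.primeFactors ⊆ q.primeFactors := by
  have hr0 : (∏ p ∈ q.primeFactors, p) ^ J ≠ 0 :=
    pow_ne_zero _ (Finset.prod_ne_zero_iff.2 fun p hp => (Nat.prime_of_mem_primeFactors hp).ne_zero)
  have hkd : k ∣ (∏ p ∈ q.primeFactors, p) ^ J := Nat.dvd_of_mem_divisors hk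
  refine ⟨(Nat.pos_of_mem_divisors hk).ne', ?_⟩
  rcases Nat.eq_zero_or_pos J with rfl | hJ
  · rw [pow_zero, Nat.dvd_one] at hkd
    rw [hkd]; simp
  · have := Nat.primeFactors_mono hkd hr0
    rwa [Nat.primeFactors_pow _ hJ.ne', Nat.primeFactors_prod fun p hp => Nat.prime_of_mem_primeFactors hp]
      at this

/-- `∑_{k ∣ (rad q)^J} g(k) = ∏_{p ∣ q} ∑_{j ≤ J} g(p^j)` for multiplicative `g`. [folklore] -/
theorem sum_divisors_radical_pow_eq {q : ℕ} (J : ℕ) {g : ArithmeticFunction ℝ} (hg : g.IsMultiplicative) :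
    ∑ k ∈ ((∏ p ∈ q.primeFactors, p) ^ J).divisors, g k =
      ∏ p ∈ q.primeFactors, ∑ j ∈ Finset.range (J + 1), g (p ^ j) := by
  have hmul : (g * ζ).IsMultiplicative := hg.mul ArithmeticFunction.isMultiplicative_zeta.natCast
  have h1 : ∑ k ∈ ((∏ p ∈ q.primeFactors, p) ^ J).divisors, g k = (g * ζ) ((∏ p ∈ q.primeFactors, p) ^ J) :=
    (ArithmeticFunction.coe_mul_zeta_apply).symm
  rw [h1, ← Finset.prod_pow]
  rw [hmul.map_prod (fun p => p ^ J) q.primeFactors ?_]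
  · refine Finset.prod_congr rfl fun p hp => ?_
    have hpp := Nat.prime_of_mem_primeFactors hp
    rw [ArithmeticFunction.coe_mul_zeta_apply, Nat.sum_divisors_prime_pow hpp]
  · intro x hx y hy hxy
    exact (Nat.coprime_pow_primes J J (Nat.prime_of_mem_primeFactors hx)
      (Nat.prime_of_mem_primeFactors hy) hxy)

/-- **The truncated Euler product is dominated by the partial sum plus the Rankin tail**: for `N ≥ 1`
and every `J`, `∏_{p ∣ q} ∑_{j ≤ J} p^{-j} ≤ ∑_{k ≤ N, rad k ∣ q} 1/k + N^{-1/2} Π_q(1/2)`. [folklore] -/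
theorem prod_geom_le_sum_radInd_add (q : ℕ) {N : ℕ} (hN : 1 ≤ N) (J : ℕ) :
    ∏ p ∈ q.primeFactors, ∑ j ∈ Finset.range (J + 1), ((p : ℝ)⁻¹) ^ j ≤
      ∑ k ∈ (Icc 1 N).filter (fun k => k.primeFactors ⊆ q.primeFactors), (1 : ℝ) / k +
        (N : ℝ) ^ (-(1 / 2 : ℝ)) * rankinProd (1 / 2) q := by
  classical
  set D := ((∏ p ∈ q.primeFactors, p) ^ J).divisors with hD
  -- the product as a divisor sum of `k ↦ 1/k`
  have hlhs : ∏ p ∈ q.primeFactors, ∑ j ∈ Finset.range (J + 1), ((p : ℝ)⁻¹) ^ j = ∑ k ∈ D, rpowAF 1 k := by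
    rw [hD, sum_divisors_radical_pow_eq J (isMultiplicative_rpowAF 1)]
    refine Finset.prod_congr rfl fun p hp => Finset.sum_congr rfl fun j _ => ?_
    have hpp := Nat.prime_of_mem_primeFactors hp
    rw [rpowAF_apply_of_ne_zero 1 (pow_ne_zero j hpp.ne_zero), Nat.cast_pow,
      Real.rpow_neg (by positivity), Real.rpow_one, inv_pow]
  have hhalf : ∑ k ∈ D, rpowAF (1 / 2) k ≤ rankinProd (1 / 2) q := by
    rw [hD, sum_divisors_radical_pow_eq J (isMultiplicative_rpowAF (1 / 2))]
    unfold rankinProd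
    refine Finset.prod_le_prod (fun p _ => Finset.sum_nonneg fun j _ => ?_) fun p hp => ?_
    · rw [rpowAF_apply]; split_ifs <;> positivity
    · have hpp := Nat.prime_of_mem_primeFactors hp
      obtain ⟨h0, h1⟩ := prime_rpow_neg_lt_one hpp (by norm_num : (0 : ℝ) < 1 / 2)
      have hterm : ∀ j ∈ Finset.range (J + 1), rpowAF (1 / 2) (p ^ j) = ((p : ℝ) ^ (-(1 / 2 : ℝ))) ^ j := by
        intro j _
        rw [rpowAF_apply_of_ne_zero _ (pow_ne_zero j hpp.ne_zero), Nat.cast_pow, ← Real.rpow_natCast,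
          ← Real.rpow_natCast, ← Real.rpow_mul (Nat.cast_nonneg _), ← Real.rpow_mul (Nat.cast_nonneg _),
          mul_comm]
      rw [Finset.sum_congr rfl hterm]
      have := geom_sum_Ico_le_of_lt_one h0 h1 (m := 0) (n := J + 1)
      rw [Finset.range_eq_Ico]
      simpa using this
  rw [hlhs]
  -- split `D` at `N`
  have hsplit : ∑ k ∈ D, rpowAF 1 k = ∑ k ∈ D.filter (fun k => k ≤ N), rpowAF 1 k +
      ∑ k ∈ D.filter (fun k => ¬ k ≤ N), rpowAF 1 k := (Finset.sum_filter_add_sum_filter_not _ _ _).symm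
  rw [hsplit]
  refine add_le_add ?_ ?_
  · -- small divisors inject into the `rad ∣ q` numbers `≤ N`
    have hval : ∀ k ∈ D.filter (fun k => k ≤ N), rpowAF 1 k = (1 : ℝ) / k := by
      intro k hk
      have hk0 := (primeFactors_subset_of_dvd_radical_pow (Finset.mem_filter.1 hk).1).1
      rw [rpowAF_apply_of_ne_zero 1 hk0, Real.rpow_neg (Nat.cast_nonneg _), Real.rpow_one, one_div]
    rw [Finset.sum_congr rfl hval]
    refine Finset.sum_le_sum_of_subset_of_nonneg ?_ fun k _ _ => by positivity
    intro k hk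
    obtain ⟨hkD, hkN⟩ := Finset.mem_filter.1 hk
    obtain ⟨hk0, hsub⟩ := primeFactors_subset_of_dvd_radical_pow hkD
    exact Finset.mem_filter.2 ⟨Finset.mem_Icc.2 ⟨Nat.pos_of_ne_zero hk0, hkN⟩, hsub⟩
  · -- large divisors: `1/k ≤ N^{-1/2} k^{-1/2}`
    have hN0 : (0 : ℝ) < N := by exact_mod_cast hN
    have hstep : ∀ k ∈ D.filter (fun k => ¬ k ≤ N), rpowAF 1 k ≤ (N : ℝ) ^ (-(1 / 2 : ℝ)) * rpowAF (1 / 2) k := by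
      intro k hk
      obtain ⟨hkD, hkN⟩ := Finset.mem_filter.1 hk
      have hk0 := (primeFactors_subset_of_dvd_radical_pow hkD).1
      have hkN' : (N : ℝ) ≤ k := by exact_mod_cast (not_le.1 hkN).le
      have hk0' : (0 : ℝ) < k := by exact_mod_cast Nat.pos_of_ne_zero hk0
      rw [rpowAF_apply_of_ne_zero 1 hk0, rpowAF_apply_of_ne_zero _ hk0]
      have hsplit' : (k : ℝ) ^ (-(1 : ℝ)) = (k : ℝ) ^ (-(1 / 2 : ℝ)) * (k : ℝ) ^ (-(1 / 2 : ℝ)) := by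
        rw [← Real.rpow_add hk0', show (-(1 / 2 : ℝ)) + -(1 / 2 : ℝ) = -1 by norm_num]
      rw [hsplit']
      refine mul_le_mul_of_nonneg_right ?_ (Real.rpow_nonneg hk0'.le _)
      exact Real.rpow_le_rpow_of_nonpos hN0 hkN' (by norm_num)
    refine (Finset.sum_le_sum hstep).trans ?_
    rw [← Finset.mul_sum]
    refine mul_le_mul_of_nonneg_left ?_ (Real.rpow_nonneg hN0.le _)
    refine le_trans ?_ hhalf
    refine Finset.sum_le_sum_of_subset_of_nonneg (Finset.filter_subset _ _) fun k _ _ => ?_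
    rw [rpowAF_apply]; split_ifs <;> positivity

/-- **`q/φ(q) ≤ ∑_{k ≤ N, rad k ∣ q} 1/k + N^{-1/2} Π_q(1/2)`** (`N ≥ 1`): let `J → ∞` in
`prod_geom_le_sum_radInd_add`. [folklore] -/
theorem div_totient_le_sum_radInd_add {q : ℕ} (hq : q ≠ 0) {N : ℕ} (hN : 1 ≤ N) :
    (q : ℝ) / (q.totient : ℝ) ≤
      ∑ k ∈ (Icc 1 N).filter (fun k => k.primeFactors ⊆ q.primeFactors), (1 : ℝ) / k +
        (N : ℝ) ^ (-(1 / 2 : ℝ)) * rankinProd (1 / 2) q := by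
  have hlim : Tendsto (fun J : ℕ => ∏ p ∈ q.primeFactors, ∑ j ∈ Finset.range (J + 1), ((p : ℝ)⁻¹) ^ j)
      atTop (nhds (∏ p ∈ q.primeFactors, (1 - (p : ℝ)⁻¹)⁻¹)) := by
    refine tendsto_finsetProd _ fun p hp => ?_
    have hpp := Nat.prime_of_mem_primeFactors hp
    have h0 : 0 ≤ (p : ℝ)⁻¹ := by positivity
    have h1 : (p : ℝ)⁻¹ < 1 := inv_lt_one_of_one_lt₀ (by exact_mod_cast hpp.one_lt)
    have h := (hasSum_geometric_of_lt_one h0 h1).tendsto_sum_nat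
    exact h.comp (tendsto_add_atTop_nat 1)
  have heq : ∏ p ∈ q.primeFactors, (1 - (p : ℝ)⁻¹)⁻¹ = (q : ℝ) / (q.totient : ℝ) := by
    rw [div_totient_eq_rankinProd hq]
    unfold rankinProd
    refine Finset.prod_congr rfl fun p _ => ?_
    rw [Real.rpow_neg (Nat.cast_nonneg _), Real.rpow_one]
  rw [← heq]
  exact le_of_tendsto' hlim fun J => prod_geom_le_sum_radInd_add q hN J

/-! ### Bounds for `M_q(y)` -/

/-- **`|M_q(y)| ≤ B q/φ(q)`** when `|M| ≤ B`. [cite: GreenTaoAnnals2008, Lemma 10.3] -/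
theorem abs_moebLogCop_le {B : ℝ} (hB : ∀ y, |moebLog y| ≤ B) {q : ℕ} (hq : q ≠ 0) (y : ℝ) :
    |moebLogCop q y| ≤ B * ((q : ℝ) / (q.totient : ℝ)) := by
  have hB0 : 0 ≤ B := (abs_nonneg _).trans (hB 0)
  rw [moebLogCop_eq_sum hq]
  refine (Finset.abs_sum_le_sum_abs _ _).trans ?_
  have hstep : ∀ k ∈ (Icc 1 ⌊y⌋₊).filter (fun k => k.primeFactors ⊆ q.primeFactors),
      |moebLog (y / k) / k| ≤ B * ((1 : ℝ) / k) := by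
    intro k hk
    have hk0 : (0 : ℝ) < k := by exact_mod_cast (Finset.mem_Icc.1 (Finset.mem_filter.1 hk).1).1
    rw [abs_div, Nat.abs_cast, mul_one_div]
    exact div_le_div_of_nonneg_right (hB _) hk0.le
  refine (Finset.sum_le_sum hstep).trans ?_
  rw [← Finset.mul_sum]
  exact mul_le_mul_of_nonneg_left (sum_radInd_div_le hq _) hB0

/-- **`M_q(y) = (1 + o(1)) q/φ(q)`, quantitatively**: if `|M| ≤ B` everywhere and `|M(u) - 1| ≤ η`
for `u ≥ U ≥ 1`, then for `y ≥ U`,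
`|M_q(y) - q/φ(q)| ≤ η q/φ(q) + (B + 3) (U/y)^{1/2} Π_q(1/2)`
(main part `k ≤ y/U`, where `M(y/k) = 1 + O(η)`; Rankin for `k > y/U` and for the tail of `∑ 1/k`).
[cite: GreenTaoAnnals2008, Lemma 10.3] -/
theorem abs_moebLogCop_sub_le {B η U : ℝ} (hB : ∀ y, |moebLog y| ≤ B) (hU : 1 ≤ U) (hη : 0 ≤ η)
    (hMU : ∀ u : ℝ, U ≤ u → |moebLog u - 1| ≤ η) {q : ℕ} (hq : q ≠ 0) {y : ℝ} (hy : U ≤ y) :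
    |moebLogCop q y - (q : ℝ) / (q.totient : ℝ)| ≤
      η * ((q : ℝ) / (q.totient : ℝ)) + (B + 3) * (U / y) ^ (1 / 2 : ℝ) * rankinProd (1 / 2) q := by
  classical
  have hB0 : 0 ≤ B := (abs_nonneg _).trans (hB 0)
  have hy1 : 1 ≤ y := hU.trans hy
  have hy0 : 0 < y := by linarith
  have hU0 : 0 < U := by linarith
  set Y := ⌊y⌋₊ with hYdef
  have hY1 : 1 ≤ Y := Nat.le_floor (by simpa using hy1)
  set F := (Icc 1 Y).filter (fun k => k.primeFactors ⊆ q.primeFactors) with hF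
  set Q : ℝ := (q : ℝ) / (q.totient : ℝ) with hQ
  set P : ℝ := rankinProd (1 / 2) q with hP
  have hP1 : 1 ≤ P := one_le_rankinProd (by norm_num) q
  have hP0 : 0 ≤ P := zero_le_one.trans hP1
  -- decomposition `M_q = S + E`
  have hdec : moebLogCop q y = ∑ k ∈ F, (1 : ℝ) / k + ∑ k ∈ F, (moebLog (y / k) - 1) / k := by
    rw [moebLogCop_eq_sum hq, ← Finset.sum_add_distrib]
    refine Finset.sum_congr rfl fun k _ => ?_
    ring
  -- the ratio `(U/y)^{1/2}` dominates `Y^{-1/2}` and `(y/U)^{-1/2}`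
  set ρ : ℝ := (U / y) ^ (1 / 2 : ℝ) with hρ
  have hρ0 : 0 ≤ ρ := Real.rpow_nonneg (by positivity) _
  have hVρ : (y / U) ^ (-(1 / 2 : ℝ)) = ρ := by
    rw [hρ, Real.rpow_neg (by positivity), ← Real.inv_rpow (by positivity), inv_div]
  have hYρ : (Y : ℝ) ^ (-(1 / 2 : ℝ)) ≤ 2 * ρ := by
    -- `Y ≥ y/2 ≥ y/(4U)` so `Y^{-1/2} ≤ 2 (U/y)^{1/2}`
    have hYy : y / (4 * U) ≤ Y := by
      have h1 : y / 2 ≤ Y := by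
        have := Nat.lt_floor_add_one y
        rw [← hYdef] at this
        have hY1' : (1 : ℝ) ≤ Y := by exact_mod_cast hY1
        linarith
      have h2 : y / (4 * U) ≤ y / 2 := by
        apply div_le_div_of_nonneg_left hy0.le (by norm_num) (by linarith)
      linarith
    have hpos : 0 < y / (4 * U) := by positivity
    calc (Y : ℝ) ^ (-(1 / 2 : ℝ)) ≤ (y / (4 * U)) ^ (-(1 / 2 : ℝ)) :=
          Real.rpow_le_rpow_of_nonpos hpos hYy (by norm_num)
      _ = (4 * (U / y)) ^ (1 / 2 : ℝ) := by
          rw [Real.rpow_neg hpos.le, ← Real.inv_rpow hpos.le]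
          congr 1
          field_simp
      _ = 2 * ρ := by
          rw [hρ, Real.mul_rpow (by norm_num) (by positivity)]
          congr 1
          rw [show (4 : ℝ) = 2 ^ (2 : ℝ) by norm_num, ← Real.rpow_mul (by norm_num)]
          norm_num
  -- `S` versus `q/φ(q)`
  have hS_le : ∑ k ∈ F, (1 : ℝ) / k ≤ Q := sum_radInd_div_le hq Y
  have hS_ge : Q ≤ ∑ k ∈ F, (1 : ℝ) / k + (Y : ℝ) ^ (-(1 / 2 : ℝ)) * P := div_totient_le_sum_radInd_add hq hY1
  -- `E`: split at `V = y/U`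
  set V : ℝ := y / U with hV
  have hV1 : 1 ≤ V := by rw [hV, le_div_iff₀ hU0, one_mul]; exact hy
  have hE : |∑ k ∈ F, (moebLog (y / k) - 1) / k| ≤ η * Q + (B + 1) * (ρ * P) := by
    have hsplitF : ∑ k ∈ F, (moebLog (y / k) - 1) / k =
        ∑ k ∈ F.filter (fun k => k ≤ ⌊V⌋₊), (moebLog (y / k) - 1) / k +
        ∑ k ∈ F.filter (fun k => ¬ k ≤ ⌊V⌋₊), (moebLog (y / k) - 1) / k :=
      (Finset.sum_filter_add_sum_filter_not _ _ _).symm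
    rw [hsplitF]
    refine (abs_add_le _ _).trans (add_le_add ?_ ?_)
    · -- `k ≤ V`: `y/k ≥ U`
      refine (Finset.abs_sum_le_sum_abs _ _).trans ?_
      have hstep : ∀ k ∈ F.filter (fun k => k ≤ ⌊V⌋₊), |(moebLog (y / k) - 1) / k| ≤ η * ((1 : ℝ) / k) := by
        intro k hk
        obtain ⟨hkF, hkV⟩ := Finset.mem_filter.1 hk
        have hk1 : 1 ≤ k := (Finset.mem_Icc.1 (Finset.mem_filter.1 hkF).1).1
        have hk0 : (0 : ℝ) < k := by exact_mod_cast hk1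
        have hkV' : (k : ℝ) ≤ V := (Nat.cast_le.2 hkV).trans (Nat.floor_le (by linarith))
        have hyk : U ≤ y / k := by
          rw [le_div_iff₀ hk0]
          calc U * k ≤ U * V := by gcongr
            _ = y := by rw [hV]; field_simp
        rw [abs_div, Nat.abs_cast, mul_one_div]
        exact div_le_div_of_nonneg_right (hMU _ hyk) hk0.le
      refine (Finset.sum_le_sum hstep).trans ?_
      rw [← Finset.mul_sum]
      refine mul_le_mul_of_nonneg_left (le_trans ?_ hS_le) hη
      exact Finset.sum_le_sum_of_subset_of_nonneg (Finset.filter_subset _ _) fun k _ _ => by positivity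
    · -- `k > V`: Rankin
      refine (Finset.abs_sum_le_sum_abs _ _).trans ?_
      have hstep : ∀ k ∈ F.filter (fun k => ¬ k ≤ ⌊V⌋₊), |(moebLog (y / k) - 1) / k| ≤ (B + 1) * ((1 : ℝ) / k) := by
        intro k hk
        have hk1 : 1 ≤ k := (Finset.mem_Icc.1 (Finset.mem_filter.1 (Finset.mem_filter.1 hk).1).1).1
        have hk0 : (0 : ℝ) < k := by exact_mod_cast hk1
        rw [abs_div, Nat.abs_cast, mul_one_div]
        refine div_le_div_of_nonneg_right ?_ hk0.le
        calc |moebLog (y / k) - 1| ≤ |moebLog (y / k)| + 1 := by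
              simpa using abs_sub (moebLog (y / k)) 1
          _ ≤ B + 1 := by linarith [hB (y / k)]
      refine (Finset.sum_le_sum hstep).trans ?_
      rw [← Finset.mul_sum]
      refine mul_le_mul_of_nonneg_left ?_ (by linarith)
      have htail := sum_radInd_div_Ioc_le hq hV1 Y
      rw [hVρ] at htail
      refine le_trans (le_of_eq ?_) htail
      apply Finset.sum_congr _ fun _ _ => rfl
      ext k
      simp only [hF, Finset.mem_filter, Finset.mem_Icc, Finset.mem_Ioc, not_le]
      constructor
      · rintro ⟨⟨⟨hk1, hkY⟩, hsub⟩, hkV⟩; exact ⟨⟨hkV, hkY⟩, hsub⟩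
      · rintro ⟨⟨hkV, hkY⟩, hsub⟩; exact ⟨⟨⟨by omega, hkY⟩, hsub⟩, hkV⟩
  -- assemble
  have hmain : |moebLogCop q y - Q| ≤ η * Q + (B + 1) * (ρ * P) + 2 * ρ * P := by
    rw [hdec]
    have h1 : |∑ k ∈ F, (1 : ℝ) / k - Q| ≤ 2 * ρ * P := by
      rw [abs_sub_comm, abs_of_nonneg (by linarith)]
      calc Q - ∑ k ∈ F, (1 : ℝ) / k ≤ (Y : ℝ) ^ (-(1 / 2 : ℝ)) * P := by linarith
        _ ≤ 2 * ρ * P := mul_le_mul_of_nonneg_right hYρ hP0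
    calc |∑ k ∈ F, (1 : ℝ) / k + ∑ k ∈ F, (moebLog (y / k) - 1) / k - Q|
        = |(∑ k ∈ F, (1 : ℝ) / k - Q) + ∑ k ∈ F, (moebLog (y / k) - 1) / k| := by ring_nf
      _ ≤ |∑ k ∈ F, (1 : ℝ) / k - Q| + |∑ k ∈ F, (moebLog (y / k) - 1) / k| := abs_add_le _ _
      _ ≤ 2 * ρ * P + (η * Q + (B + 1) * (ρ * P)) := add_le_add h1 hE
      _ = _ := by ring
  calc |moebLogCop q y - Q| ≤ η * Q + (B + 1) * (ρ * P) + 2 * ρ * P := hmain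
    _ = η * Q + (B + 3) * ρ * P := by ring

end Literature.NumberTheory.Sieve.GreenTao2008.SharpGY
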